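import Summits.CriticalPhenomena.PercolationContinuityZ3.Theorems.PercNearOneGluingNoHeavyLowerTailKnQuestion8CoefficientwiseCoreClassKernelMixBouquetModel
import HarnessLib

/-!
# CONJECTURE IET on every bundle with a unit thread, I: the 0/1 count (L5 link, part 4 — the two-type theorem meets the bundle)

Support file (`--supports stmt-CriticalPhenomena-4575`, closed), prover `prim-cplus-coupling` (gen 67).  No definitions, no notations, no named facts, no sorries;
standard axioms.  Memos `prim-cplus-coupling/A5-COUPLING-gen61.md` §3.2 (bouquet form of IET), `A5-COUPLING-gen66.md` (two-type theorem), `A5-COUPLING-gen67.md` §1.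

THEOREM `Coefficientwise.bundle_unit_thread_count`: on an explicit bundle `Θ(ℓ₀, …, ℓ_{r−1})` (hubs `u, b`, `r` internally disjoint threads of arbitrary lengths)
containing a UNIT THREAD `tc` (`L tc = 1`, the edge `u b`), for EVERY up-closed event `𝒱` and all monotone `{0,1}`-valued levels `hᵃ, hᵇ ≤ h`, `kᵃ, kᵇ ≤ k`:
  `#bad₁(𝒱) + #bad₂(𝒱) ≤ #{λ ∈ 𝒱 supply : h(X) = k(X) = 1} + #P₁(𝒱)`     (`X = C_u(ω)` red cluster, `Y = C_u(E∖ω)` blue cluster).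
PROOF (memo-61 §3.2 made formal).  With a unit thread, a colouring is a demand point (`b ∈ Y ∖ X`) iff no thread is fully red, and a supply point (`b ∈ X ∖ Y`) iff no
thread is fully blue; so the chord never has to be eliminated — it is the LOOP factor of the bouquet `Θ/(u=b)`.  `BouquetModel.bouquet_model` transports the colourings
onto a bouquet H-space `H` (order isomorphism `Ψ`, complement ↦ mirror, demand region ↦ `H.NF`), the exact blue-cluster levels `{kᵇ(Y) = 1}`, `{hᵇ(Y) = 1}` are
levels of `H` (`GenLevels` + `ThreadWords.bundle_cluster_eq_runs`), the `u`-side levels `𝒱 ∩ {hᵃ(X) = 1}`, `𝒱 ∩ {kᵃ(X) = 1}` are upper sets, and the two-type inequality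
`Bouquet.HBundle.x2` (gen 66: bi-disciplined recursive matchings + chain shift + Lemma C) is pulled back along `Ψ`: its left side dominates `#bad₁ + #bad₂`, its three
target terms are disjoint families of supply points with `h = k = 1`, and its pool term is `P₁`.  The real-level statement is `…KernelMixBundleWithUnitThreadIET`.
[cite: KozmaNitzan2024, Questions 8–9 (§5.5 p. 36) (context); Harris 1960; Kleitman 1966]
-/

namespace Summit.CriticalPhenomena.PercolationContinuityZ3.Theorems

open Finset Literature.Probability.Percolation

namespace Coefficientwise

variable {ι V : Type*}

open Classical in
/-- **CONJECTURE IET, count form, on every bundle with a unit thread** (all 0/1 levels, every up-set).  Module docstring.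
[cite: KozmaNitzan2024, Questions 8–9 (§5.5 p. 36) (context); Harris 1960; Kleitman 1966] -/
theorem bundle_unit_thread_count (ends : ι → Sym2 V) (r : ℕ) (L : ℕ → ℕ) (hL : ∀ t, t < r → 1 ≤ L t)
    (w : ℕ → ℕ → V) (e : ℕ → ℕ → ι) (u b : V)
    (hw0 : ∀ t, t < r → w t 0 = u) (hwL : ∀ t, t < r → w t (L t) = b)
    (harc : ∀ t, t < r → ∀ j, 1 ≤ j → j ≤ L t → ends (e t j) = s(w t (j - 1), w t j))
    (hwinj : ∀ t, t < r → ∀ i j, i ≤ L t → j ≤ L t → w t i = w t j → i = j)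
    (hcross : ∀ t t', t < r → t' < r → t ≠ t' → ∀ i j, i ≤ L t → j ≤ L t' → w t i = w t' j → (i = 0 ∧ j = 0) ∨ (i = L t ∧ j = L t'))
    (A : ℕ → Finset ι) (hA : ∀ t, t < r → ∀ i, i ∈ A t ↔ ∃ j, 1 ≤ j ∧ j ≤ L t ∧ e t j = i)
    (hAdisj : ∀ t t', t < r → t' < r → t ≠ t' → Disjoint (A t) (A t'))
    (E : Finset ι) (hEA : ∀ i, i ∈ E ↔ ∃ t, t < r ∧ i ∈ A t)
    (tc : ℕ) (htc : tc < r) (hunit : L tc = 1)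
    (𝒱 : Finset ι → Prop) (hV : ∀ ⦃s t : Finset ι⦄, s ⊆ t → 𝒱 s → 𝒱 t)
    (h k ha hb ka kb : Set V → ℝ) (mha : Monotone ha) (mhb : Monotone hb) (mka : Monotone ka) (mkb : Monotone kb)
    (h01' : ∀ S, h S = 0 ∨ h S = 1) (k01 : ∀ S, k S = 0 ∨ k S = 1)
    (ha01 : ∀ S, ha S = 0 ∨ ha S = 1) (hb01 : ∀ S, hb S = 0 ∨ hb S = 1) (ka01 : ∀ S, ka S = 0 ∨ ka S = 1) (kb01 : ∀ S, kb S = 0 ∨ kb S = 1)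
    (hah : ∀ S, ha S ≤ h S) (hbh : ∀ S, hb S ≤ h S) (kak : ∀ S, ka S ≤ k S) (kbk : ∀ S, kb S ≤ k S) :
    ((E.powerset).filter (fun σ => 𝒱 σ ∧
        (b ∈ openCluster (ends '' (↑(E \ σ) : Set ι)) u ∧ b ∉ openCluster (ends '' (↑σ : Set ι)) u) ∧
        (ha (openCluster (ends '' (↑σ : Set ι)) u) = 1 ∧ hb (openCluster (ends '' (↑(E \ σ) : Set ι)) u) = 0) ∧
        (kb (openCluster (ends '' (↑(E \ σ) : Set ι)) u) = 1 ∧ ka (openCluster (ends '' (↑σ : Set ι)) u) = 0))).card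
    + ((E.powerset).filter (fun σ => 𝒱 σ ∧
        (b ∈ openCluster (ends '' (↑(E \ σ) : Set ι)) u ∧ b ∉ openCluster (ends '' (↑σ : Set ι)) u) ∧
        (ka (openCluster (ends '' (↑σ : Set ι)) u) = 1 ∧ kb (openCluster (ends '' (↑(E \ σ) : Set ι)) u) = 0) ∧
        (hb (openCluster (ends '' (↑(E \ σ) : Set ι)) u) = 1 ∧ ha (openCluster (ends '' (↑σ : Set ι)) u) = 0))).card
    ≤ ((E.powerset).filter (fun lam => 𝒱 lam ∧
        (b ∈ openCluster (ends '' (↑lam : Set ι)) u ∧ b ∉ openCluster (ends '' (↑(E \ lam) : Set ι)) u) ∧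
        h (openCluster (ends '' (↑lam : Set ι)) u) = 1 ∧ k (openCluster (ends '' (↑lam : Set ι)) u) = 1)).card
      + ((E.powerset).filter (fun σ => 𝒱 σ ∧
        (b ∈ openCluster (ends '' (↑(E \ σ) : Set ι)) u ∧ b ∉ openCluster (ends '' (↑σ : Set ι)) u) ∧
        (ha (openCluster (ends '' (↑σ : Set ι)) u) = 1 ∧ ka (openCluster (ends '' (↑σ : Set ι)) u) = 1 ∧
          hb (openCluster (ends '' (↑(E \ σ) : Set ι)) u) = 0 ∧ kb (openCluster (ends '' (↑(E \ σ) : Set ι)) u) = 0))).card := by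
  set C : Finset ι → Set V := fun ω => openCluster (ends '' (↑ω : Set ι)) u with hC
  have hr : 0 < r := lt_of_le_of_lt (Nat.zero_le _) htc
  have heA : ∀ t, t < r → ∀ j, 1 ≤ j → j ≤ L t → e t j ∈ A t := fun t ht j hj1 hjL => (hA t ht _).mpr ⟨j, hj1, hjL, rfl⟩
  have heE : ∀ t, t < r → ∀ j, 1 ≤ j → j ≤ L t → e t j ∈ E := fun t ht j hj1 hjL => (hEA _).mpr ⟨t, ht, heA t ht j hj1 hjL⟩
  have hE' : ∀ i, i ∈ E → ∃ t, t < r ∧ ∃ j, 1 ≤ j ∧ j ≤ L t ∧ e t j = i := by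
    intro i hi
    obtain ⟨t, ht, hit⟩ := (hEA i).mp hi
    exact ⟨t, ht, (hA t ht i).mp hit⟩
  -- edges of one thread are pairwise distinct
  have einj : ∀ t, t < r → ∀ i j, 1 ≤ i → i ≤ L t → 1 ≤ j → j ≤ L t → e t i = e t j → i = j := by
    intro t ht i j hi1 hiL hj1 hjL hij
    have h := harc t ht i hi1 hiL
    rw [hij, harc t ht j hj1 hjL] at h
    rcases Sym2.eq_iff.mp h with ⟨h1, _⟩ | ⟨h1, h2⟩
    · have := hwinj t ht (j - 1) (i - 1) (by omega) (by omega) h1; omega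
    · have e1 := hwinj t ht (j - 1) i (by omega) hiL h1
      have e2 := hwinj t ht j (i - 1) hjL (by omega) h2
      omega
  have hEeq : (range r).biUnion A = E := by
    ext i; rw [BouquetModel.mem_biUnion_range, hEA]
  -- 0/1 bookkeeping
  have one_of_ge : ∀ (f : Set V → ℝ), (∀ S, f S = 0 ∨ f S = 1) → ∀ S S' : Set V, S ⊆ S' → Monotone f → f S = 1 → f S' = 1 := by
    intro f f01 S S' hSS' mf h1
    rcases f01 S' with h0 | h0
    · have := mf hSS'; rw [h1, h0] at this; linarith
    · exact h0
  have up1 : ∀ (f g : Set V → ℝ), (∀ S, g S = 0 ∨ g S = 1) → (∀ S, f S ≤ g S) → ∀ S, f S = 1 → g S = 1 := by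
    intro f g g01 hfg S e1
    rcases g01 S with h0 | h0
    · have := hfg S; rw [e1, h0] at this; linarith
    · exact h0
  have ne1 : ∀ (f : Set V → ℝ), (∀ S, f S = 0 ∨ f S = 1) → ∀ S, (¬ f S = 1 ↔ f S = 0) := by
    intro f f01 S
    rcases f01 S with h0 | h0
    · rw [h0]; norm_num
    · rw [h0]; norm_num
  have Cmono : ∀ s t : Finset ι, s ⊆ t → C s ⊆ C t := fun s t hst => openCluster_mono (Set.image_mono (Finset.coe_subset.mpr hst)) u
  -- ## the bouquet model of all r threads
  obtain ⟨H, Ψ, Y, hΨE, hord, hsurj, hmir, hNF, hgen, hY⟩ :=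
    BouquetModel.bouquet_model r L hL w e u b einj A hA hAdisj r le_rfl
  rw [hEeq] at hΨE hord hsurj hmir
  -- ## demand / supply regions with a unit thread
  have full_iff : ∀ ω : Finset ι, ω ⊆ E → (b ∈ C ω ↔ ∃ t, t < r ∧ A t ⊆ ω) := fun ω hω =>
    bundle_b_mem_cluster_iff_threads ends r L hL w e u b hr hw0 hwL harc hwinj hcross A hA E hEA ω hω
  have hAtc : ∀ ω : Finset ι, e tc 1 ∈ ω → A tc ⊆ ω := by
    intro ω h1 x hx
    obtain ⟨j, hj1, hjL, rfl⟩ := (hA tc htc x).mp hx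
    rw [hunit] at hjL
    obtain rfl : j = 1 := le_antisymm hjL hj1
    exact h1
  have dem_iff : ∀ σ : Finset ι, σ ⊆ E → ((b ∈ C (E \ σ) ∧ b ∉ C σ) ↔ ∀ t, t < r → ¬ A t ⊆ σ) := by
    intro σ hσ
    constructor
    · rintro ⟨-, hb⟩ t ht hsub
      exact hb ((full_iff σ hσ).mpr ⟨t, ht, hsub⟩)
    · intro hn
      refine ⟨(full_iff (E \ σ) sdiff_subset).mpr ⟨tc, htc, hAtc _ (mem_sdiff.mpr ⟨heE tc htc 1 le_rfl (by omega), fun h1 => hn tc htc (hAtc σ h1)⟩)⟩, ?_⟩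
      rintro hb
      obtain ⟨t, ht, hsub⟩ := (full_iff σ hσ).mp hb
      exact hn t ht hsub
  have sup_iff : ∀ lam : Finset ι, lam ⊆ E → ((b ∈ C lam ∧ b ∉ C (E \ lam)) ↔ ∀ t, t < r → ¬ A t ⊆ E \ lam) := by
    intro lam hlam
    constructor
    · rintro ⟨-, hb⟩ t ht hsub
      exact hb ((full_iff (E \ lam) sdiff_subset).mpr ⟨t, ht, hsub⟩)
    · intro hn
      refine ⟨(full_iff lam hlam).mpr ⟨tc, htc, hAtc _ ?_⟩, fun hb => ?_⟩
      · by_contra h1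
        exact hn tc htc (hAtc _ (mem_sdiff.mpr ⟨heE tc htc 1 le_rfl (by omega), h1⟩))
      · obtain ⟨t, ht, hsub⟩ := (full_iff (E \ lam) sdiff_subset).mp hb
        exact hn t ht hsub
  -- ## the blue cluster of a demand point is the model's cluster map
  have hYC : ∀ σ : Finset ι, σ ⊆ E → (∀ t, t < r → ¬ A t ⊆ σ) → Y (Ψ σ) = C (E \ σ) := by
    intro σ hσ hn
    have hb : b ∈ C (E \ σ) := ((dem_iff σ hσ).mpr hn).1
    rw [hY σ]
    exact (ThreadWords.bundle_cluster_eq_runs ends r L w e u b hr hw0 hwL harc hwinj hcross E hE' heE σ hb).symm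
  -- ## injectivity of Ψ on colourings of E
  have hinj : ∀ σ σ' : Finset ι, σ ⊆ E → σ' ⊆ E → Ψ σ = Ψ σ' → σ = σ' := by
    intro σ σ' hσ hσ' heq
    have h1 := (hord σ σ').mp (le_of_eq heq)
    have h2 := (hord σ' σ).mp (le_of_eq heq.symm)
    rw [inter_eq_left.mpr hσ, inter_eq_left.mpr hσ'] at h1 h2
    exact Subset.antisymm h1 h2
  have hsdiffE : ∀ σ : Finset ι, σ ⊆ E → E \ (E \ σ) = σ := fun σ hσ => by
    rw [sdiff_sdiff_right_self, inf_eq_inter, inter_eq_right.mpr hσ]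
  -- ## the H-side sets
  set AH : Finset H.X := ((E.powerset).filter (fun σ => 𝒱 σ ∧ ha (C σ) = 1)).image Ψ with hAH
  set CH : Finset H.X := ((E.powerset).filter (fun σ => 𝒱 σ ∧ ka (C σ) = 1)).image Ψ with hCH
  set DH : Finset H.X := H.NF.filter (fun x => kb (Y x) = 1) with hDH
  set BH : Finset H.X := H.NF.filter (fun x => hb (Y x) = 1) with hBH
  set NEH : Finset H.X := univ.filter (fun x => H.c x ∈ H.NF) with hNEH
  have hDlev : H.Level DH := hgen (fun S => kb S = 1) (fun S T hST hS => one_of_ge kb kb01 S T hST mkb hS)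
  have hBlev : H.Level BH := hgen (fun S => hb S = 1) (fun S T hST hS => one_of_ge hb hb01 S T hST mhb hS)
  have upper_of : ∀ (f : Set V → ℝ), (∀ S, f S = 0 ∨ f S = 1) → Monotone f →
      IsUpperSet ((((E.powerset).filter (fun σ => 𝒱 σ ∧ f (C σ) = 1)).image Ψ : Finset H.X) : Set H.X) := by
    intro f f01 mf x y hxy hx
    rw [mem_coe, mem_image] at hx ⊢
    obtain ⟨σ, hσ, rfl⟩ := hx
    obtain ⟨hσE, hv, hf⟩ := mem_filter.mp hσ
    rw [mem_powerset] at hσE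
    obtain ⟨σ', hσ'E, rfl⟩ := hsurj y
    have hss : σ ⊆ σ' := by
      have := (hord σ σ').mp hxy
      rwa [inter_eq_left.mpr hσE, inter_eq_left.mpr hσ'E] at this
    exact ⟨σ', mem_filter.mpr ⟨mem_powerset.mpr hσ'E, hV hss hv, one_of_ge f f01 _ _ (Cmono σ σ' hss) mf hf⟩, rfl⟩
  have hAup : IsUpperSet (AH : Set H.X) := upper_of ha ha01 mha
  have hCup : IsUpperSet (CH : Set H.X) := upper_of ka ka01 mka
  have hNE₁ : univ.filter (fun x => H.c x ∈ DH) ⊆ NEH := by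
    intro x hx; rw [mem_filter] at hx ⊢; exact ⟨hx.1, (mem_filter.mp hx.2).1⟩
  have hNE₂ : univ.filter (fun x => H.c x ∈ BH) ⊆ NEH := by
    intro x hx; rw [mem_filter] at hx ⊢; exact ⟨hx.1, (mem_filter.mp hx.2).1⟩
  -- ## THE TWO-TYPE THEOREM on the bouquet
  have key := H.x2 DH BH hDlev hBlev NEH hNE₁ hNE₂ AH CH hAup hCup
  -- ## membership dictionary (σ ⊆ E)
  have memU_of : ∀ (f : Set V → ℝ) (σ : Finset ι), σ ⊆ E → 𝒱 σ → f (C σ) = 1 →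
      Ψ σ ∈ ((E.powerset).filter (fun σ => 𝒱 σ ∧ f (C σ) = 1)).image Ψ :=
    fun f σ hσ hv hf => mem_image_of_mem Ψ (mem_filter.mpr ⟨mem_powerset.mpr hσ, hv, hf⟩)
  have of_memU : ∀ (f : Set V → ℝ) (σ : Finset ι), σ ⊆ E →
      Ψ σ ∈ ((E.powerset).filter (fun σ => 𝒱 σ ∧ f (C σ) = 1)).image Ψ → 𝒱 σ ∧ f (C σ) = 1 := by
    intro f σ hσ hx
    obtain ⟨σ', hσ', heq⟩ := mem_image.mp hx
    obtain ⟨hσ'E, hv, hf⟩ := mem_filter.mp hσ'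
    obtain rfl : σ' = σ := hinj σ' σ (mem_powerset.mp hσ'E) hσ heq
    exact ⟨hv, hf⟩
  have memNF : ∀ σ : Finset ι, Ψ σ ∈ H.NF ↔ ∀ t, t < r → ¬ A t ⊆ σ := hNF
  have memL : ∀ (f : Set V → ℝ) (σ : Finset ι), σ ⊆ E →
      (Ψ σ ∈ H.NF.filter (fun x => f (Y x) = 1) ↔ (∀ t, t < r → ¬ A t ⊆ σ) ∧ f (C (E \ σ)) = 1) := by
    intro f σ hσ
    rw [mem_filter, memNF]
    constructor
    · rintro ⟨hn, hf⟩; rw [hYC σ hσ hn] at hf; exact ⟨hn, hf⟩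
    · rintro ⟨hn, hf⟩; rw [← hYC σ hσ hn] at hf; exact ⟨hn, hf⟩
  have memcL : ∀ (f : Set V → ℝ) (lam : Finset ι), lam ⊆ E →
      (H.c (Ψ lam) ∈ H.NF.filter (fun x => f (Y x) = 1) ↔ (∀ t, t < r → ¬ A t ⊆ E \ lam) ∧ f (C lam) = 1) := by
    intro f lam hlam
    rw [hmir, memL f (E \ lam) sdiff_subset, hsdiffE lam hlam]
  have memcNF : ∀ lam : Finset ι, H.c (Ψ lam) ∈ H.NF ↔ ∀ t, t < r → ¬ A t ⊆ E \ lam := by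
    intro lam; rw [hmir, memNF]
  -- ## the four comparisons
  -- abbreviations for the bundle-side families
  set B₁ := (E.powerset).filter (fun σ => 𝒱 σ ∧ (b ∈ C (E \ σ) ∧ b ∉ C σ) ∧ (ha (C σ) = 1 ∧ hb (C (E \ σ)) = 0) ∧
      (kb (C (E \ σ)) = 1 ∧ ka (C σ) = 0)) with hB₁
  set B₂ := (E.powerset).filter (fun σ => 𝒱 σ ∧ (b ∈ C (E \ σ) ∧ b ∉ C σ) ∧ (ka (C σ) = 1 ∧ kb (C (E \ σ)) = 0) ∧
      (hb (C (E \ σ)) = 1 ∧ ha (C σ) = 0)) with hB₂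
  set T := (E.powerset).filter (fun lam => 𝒱 lam ∧ (b ∈ C lam ∧ b ∉ C (E \ lam)) ∧ h (C lam) = 1 ∧ k (C lam) = 1) with hT
  set P := (E.powerset).filter (fun σ => 𝒱 σ ∧ (b ∈ C (E \ σ) ∧ b ∉ C σ) ∧
      (ha (C σ) = 1 ∧ ka (C σ) = 1 ∧ hb (C (E \ σ)) = 0 ∧ kb (C (E \ σ)) = 0)) with hP
  -- (1) bad₁ ↪ (A∖C) ∩ (D∖B)
  have c1 : B₁.card ≤ ((AH \ CH) ∩ (DH \ BH)).card := by
    refine card_le_card_of_injOn Ψ (fun σ hσ => ?_) (fun σ hσ σ' hσ' heq => ?_)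
    · rw [hB₁, mem_coe, mem_filter, mem_powerset] at hσ
      obtain ⟨hσE, hv, hbb, ⟨ha1, hb0⟩, ⟨kb1, ka0⟩⟩ := hσ
      have hn := (dem_iff σ hσE).mp hbb
      rw [mem_coe, mem_inter, mem_sdiff, mem_sdiff]
      refine ⟨⟨memU_of ha σ hσE hv ha1, fun hc => ?_⟩, (memL kb σ hσE).mpr ⟨hn, kb1⟩, fun hb' => ?_⟩
      · have := (of_memU ka σ hσE hc).2; rw [ka0] at this; norm_num at this
      · have := ((memL hb σ hσE).mp hb').2; rw [hb0] at this; norm_num at this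
    · rw [hB₁, mem_coe, mem_filter, mem_powerset] at hσ hσ'
      exact hinj σ σ' hσ.1 hσ'.1 heq
  -- (2) bad₂ ↪ (C∖A) ∩ (B∖D)
  have c2 : B₂.card ≤ ((CH \ AH) ∩ (BH \ DH)).card := by
    refine card_le_card_of_injOn Ψ (fun σ hσ => ?_) (fun σ hσ σ' hσ' heq => ?_)
    · rw [hB₂, mem_coe, mem_filter, mem_powerset] at hσ
      obtain ⟨hσE, hv, hbb, ⟨ka1, kb0⟩, ⟨hb1, ha0⟩⟩ := hσ
      have hn := (dem_iff σ hσE).mp hbb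
      rw [mem_coe, mem_inter, mem_sdiff, mem_sdiff]
      refine ⟨⟨memU_of ka σ hσE hv ka1, fun hc => ?_⟩, (memL hb σ hσE).mpr ⟨hn, hb1⟩, fun hb' => ?_⟩
      · have := (of_memU ha σ hσE hc).2; rw [ha0] at this; norm_num at this
      · have := ((memL kb σ hσE).mp hb').2; rw [kb0] at this; norm_num at this
    · rw [hB₂, mem_coe, mem_filter, mem_powerset] at hσ hσ'
      exact hinj σ σ' hσ.1 hσ'.1 heq
  -- (3) the three target families are disjoint and consist of images of supply points with h = k = 1
  set X₁ : Finset H.X := (AH \ CH) ∩ univ.filter (fun x => H.c x ∈ DH) with hX₁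
  set X₂ : Finset H.X := (CH \ AH) ∩ univ.filter (fun x => H.c x ∈ BH) with hX₂
  set X₃ : Finset H.X := AH ∩ CH ∩ NEH with hX₃
  have d12 : Disjoint X₁ X₂ := by
    rw [disjoint_left]; intro x h1 h2
    exact (mem_sdiff.mp (mem_inter.mp h2).1).2 (mem_sdiff.mp (mem_inter.mp h1).1).1
  have d13 : Disjoint (X₁ ∪ X₂) X₃ := by
    rw [disjoint_left]; intro x h12 h3
    obtain ⟨⟨hxA, hxC⟩, -⟩ := mem_inter.mp h3 |>.imp_left mem_inter.mp
    rcases mem_union.mp h12 with h1 | h2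
    · exact (mem_sdiff.mp (mem_inter.mp h1).1).2 hxC
    · exact (mem_sdiff.mp (mem_inter.mp h2).1).2 hxA
  have c3 : X₁.card + X₂.card + X₃.card ≤ T.card := by
    rw [← card_union_of_disjoint d12, ← card_union_of_disjoint d13]
    refine le_trans (card_le_card (fun x hx => ?_)) (card_image_le (f := Ψ) (s := T))
    obtain ⟨lam, hlamE, rfl⟩ := hsurj x
    refine mem_image.mpr ⟨lam, ?_, rfl⟩
    rw [hT, mem_filter, mem_powerset]
    rcases mem_union.mp hx with h12 | h3
    · rcases mem_union.mp h12 with h1 | h2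
      · obtain ⟨hAC, hcD⟩ := mem_inter.mp h1
        obtain ⟨hv, ha1⟩ := of_memU ha lam hlamE (mem_sdiff.mp hAC).1
        obtain ⟨hn, kb1⟩ := (memcL kb lam hlamE).mp (mem_filter.mp hcD).2
        exact ⟨hlamE, hv, (sup_iff lam hlamE).mpr hn, up1 ha h h01' hah _ ha1, up1 kb k k01 kbk _ kb1⟩
      · obtain ⟨hCA, hcB⟩ := mem_inter.mp h2
        obtain ⟨hv, ka1⟩ := of_memU ka lam hlamE (mem_sdiff.mp hCA).1
        obtain ⟨hn, hb1⟩ := (memcL hb lam hlamE).mp (mem_filter.mp hcB).2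
        exact ⟨hlamE, hv, (sup_iff lam hlamE).mpr hn, up1 hb h h01' hbh _ hb1, up1 ka k k01 kak _ ka1⟩
    · obtain ⟨hAC, hNE⟩ := mem_inter.mp h3
      obtain ⟨hxA, hxC⟩ := mem_inter.mp hAC
      obtain ⟨hv, ha1⟩ := of_memU ha lam hlamE hxA
      obtain ⟨-, ka1⟩ := of_memU ka lam hlamE hxC
      have hn := (memcNF lam).mp (mem_filter.mp hNE).2
      exact ⟨hlamE, hv, (sup_iff lam hlamE).mpr hn, up1 ha h h01' hah _ ha1, up1 ka k k01 kak _ ka1⟩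
  -- (4) the pool term consists of images of P₁ points
  have c4 : (AH ∩ CH ∩ (H.NF \ (DH ∪ BH))).card ≤ P.card := by
    refine le_trans (card_le_card (fun x hx => ?_)) (card_image_le (f := Ψ) (s := P))
    obtain ⟨σ, hσE, rfl⟩ := hsurj x
    refine mem_image.mpr ⟨σ, ?_, rfl⟩
    rw [hP, mem_filter, mem_powerset]
    obtain ⟨hAC, hpool⟩ := mem_inter.mp hx
    obtain ⟨hxA, hxC⟩ := mem_inter.mp hAC
    obtain ⟨hxNF, hxDB⟩ := mem_sdiff.mp hpool
    rw [mem_union, not_or] at hxDB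
    obtain ⟨hv, ha1⟩ := of_memU ha σ hσE hxA
    obtain ⟨-, ka1⟩ := of_memU ka σ hσE hxC
    have hn := (memNF σ).mp hxNF
    have kb0 : kb (C (E \ σ)) = 0 := (ne1 kb kb01 _).mp fun h1 => hxDB.1 ((memL kb σ hσE).mpr ⟨hn, h1⟩)
    have hb0 : hb (C (E \ σ)) = 0 := (ne1 hb hb01 _).mp fun h1 => hxDB.2 ((memL hb σ hσE).mpr ⟨hn, h1⟩)
    exact ⟨hσE, hv, (dem_iff σ hσE).mpr hn, ha1, ka1, hb0, kb0⟩
  -- ## assembly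
  calc B₁.card + B₂.card
      ≤ ((AH \ CH) ∩ (DH \ BH)).card + ((CH \ AH) ∩ (BH \ DH)).card := add_le_add c1 c2
    _ ≤ X₁.card + X₂.card + X₃.card + (AH ∩ CH ∩ (H.NF \ (DH ∪ BH))).card := key
    _ ≤ T.card + P.card := add_le_add c3 c4

end Coefficientwise

end Summit.CriticalPhenomena.PercolationContinuityZ3.Theorems
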